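/-
COR-CM (cell pub-hodgecm2) — Δ2 BRIDGE, WALL-BREAKER 4 (seat `prover-pub-hodgecm2-d2bridge-wb-4-g0-0`), 2026-08-23: **THE ADAPTER END-SHAPE WITH (c)+(d) DISCHARGED:
adapt-1's ✔ `AdapterMuConj.thm418C_liuDictionaryPin_of_muConj` with its five (c)(d) binders `MC ∕ jHC ∕ hjHinjC ∕ hjHC ∕ piecesC` SUPPLIED BY VALUE
from tree terms at the conjugate characters' rests on the SHARED `ι₁`-presented tail** (`tailC i := restTailOne (AlgHom.id ℚ L) ι₁ …` at `ν_i`, instance `ῑ₁`) (the socket's ∕ the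
END's tail presentation `restTailOne (AlgHom.id ℚ L) ι₁ …`; instance `ῑ₁ = conj ∘ ι₁`, where the J2 interface lives).  ONE composition of
tree terms: wb-3's ✔ `nonempty_hcmPieces_atUniformRest_conjInst` (S1 at instance `ῑ₁` on the `ι₁`-presented tail via
✔ `Def45.eta_starRingEnd_comp`), prove-5's ✔ `componentAlbanesePinTotal` + `componentAlbanesePinTotal_levelLaw`, prove-2's ✔ `map43RecordAtPin` ∕
`jHPin`, prove-3's ✔ K1 `isReflexOfTypeG_conj_iff`.  THEOREMS ONLY; explicit binders; no `sorry`.  FRAMING: HC_CM is NOT proved; «Δ2 BRIDGE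
CLOSED» is NOT claimed; whether the adapter's display `hLiuᶜ` is Liu-verbatim-for-`μᶜ` (W-A) is the referees' call, not this file's.
-/
import Summits.HodgeConjecture.CorCM.D2Bridge.HcmPiecesAtPinConjInst
import Summits.HodgeConjecture.CorCM.D2Bridge.ComponentAlbanesePinLaw
import Summits.HodgeConjecture.CorCM.D2Bridge.ReflexOfTypeConj
import Summits.HodgeConjecture.CorCM.D2Bridge.AdapterMuConj
import Summits.HodgeConjecture.CorCM.D2Bridge.HcmPiecesByValueConj
import HarnessLib

set_option autoImplicit false

/-!
# Δ2 bridge — the μ ↦ μᶜ ADAPTER with (c)+(d) BY VALUE (zero (c)(d) residual)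

* (`algebraMap ∘ c = ι₁` at the instance `ῑ₁.toAlgebra` is ✔ `PiecesByValueConj.comp_cmConjRingHom_eq_of_starRingEnd`, imported.)
* `adapter_socket_sharedTail` — `∃ M jH, Injective jH ∧ (∀ g x, jH (M.ρB g x) = of g • jH x) ∧ ∀ K ≤ capThree K₀, Nonempty (HcmPieces … M
  (liuDictionaryPin …).H jH K.K … ((liuDictionaryPin …).cmClasses K i))` over the rest `U.rest (restTailOne (AlgHom.id ℚ L) ι₁ hν hwν Carν (HT.rhoΩOne …))`,
  witnesses `M := map43RecordAtPin (componentAlbanesePinTotal …) (AlgHom.id ℚ L) ι₁ hν … Dν τ' hτ'`, `jH := jHPin …`, laws ✔ `jHPin_injective` ∕ ✔ `jHPin_comm`,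
  pieces ✔ `nonempty_hcmPieces_atUniformRest_conjInst` with `hadm'` := K1 + `hsign` + `bar_bar`.
* `thm418C_liuDictionaryPin_of_muConj_byValue` — adapt-1's adapter theorem with `(c)(d)` := the above (per line, by `Exists.choose`), `Ks := capThree K₀`:
  `(liuDictionaryPin …).Thm418C` from `hbad`, the Ω-pin of record `σ hσ e he` at the `μ_i`-rests, `hLiuC` [Thm 4.18 at the `μ_iᶜ`-rests],
  the objects `Dν` (Prop. 4.6 (1)), `hsign`, `hνμ`, and the relabelled legs `hnvDC h413C h411C hsepC hK` — NO `M ∕ jH ∕ hjHinj ∕ hjH ∕ pieces` binder.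

References: Y. Liu, arXiv:2102.11518 = Camb. J. Math. 9 (2021): Thm. 4.18 (1), proof map (4.2)∕(4.3) (l. 2247–2253), Rem. 4.4, Def. 4.5 (2),
Def. 4.12; G. Shimura, *Abelian Varieties with CM* (1998) §8.3 Prop. 28.  HC_CM is NOT proved.
-/

noncomputable section

namespace Summit.HodgeConjecture.CorCM.D2Bridge.AdapterMuConjByValue

open CategoryTheory NumberField
open Literature.AlgebraicGeometry.Motives (CMType)
open Literature.AlgebraicGeometry.HodgeTheory
open Literature.AlgebraicGeometry.ShimuraVarieties.UnitaryCanonicalModel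
open Literature.NumberTheory.Automorphic Literature.NumberTheory.Automorphic.PicardCM
open Literature.NumberTheory.Automorphic.Liu2021 Literature.NumberTheory.Automorphic.Liu2021.AppendixC
open Literature.NumberTheory.Automorphic.Liu2021.AppendixC.RestOne
open Literature.NumberTheory.Transcendental (Arapura2012_Cor_15_4_6)
open Summit.HodgeConjecture.CorCM.HComp
open HodgeCM.Model HodgeCM.Model.LevelTranslate HodgeCM.Model.TowerLevel HodgeCM.Model.TowerCarrier
open HodgeCM.Literature.Theta.LiuAlbaneseModuleDatum.D2Bridge (HcmPieces)
open Summit.HodgeConjecture.CorCM.D2Bridge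

variable {L : HodgeCM.CMField} {ι₁ : L →+* ℂ}

set_option synthInstance.maxHeartbeats 400000 in
set_option maxHeartbeats 3200000 in
/-- **THE (c)+(d) SOCKET BY VALUE at the LITERAL pin for a CONJUGATE-typed served character `ν` (`Φ_ν = Φ̄(typeOfLine (line i))`), on the
shared `ι₁`-presented tail, instance `ῑ₁`** — the five fields `M ∕ jH ∕ hjHinj ∕ hjH ∕ pieces` of `SocketCD`'s SHAPE at the rest
`U.rest (restTailOne (AlgHom.id ℚ L) ι₁ hν hwν Carν (HT.rhoΩOne …))` (`U := (𝕌 i).muConj` for the adapter's END), packaged as ONE existential: `M :=` prove-2's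
✔ `map43RecordAtPin` over prove-5's ✔ J TERM `componentAlbanesePinTotal …` (level law ✔ `componentAlbanesePinTotal_levelLaw`), `jH := jHPin` (the
identity into the tower), laws ✔ `jHPin_injective` ∕ ✔ `jHPin_comm`, pieces := wb-3's ✔ `nonempty_hcmPieces_atUniformRest_conjInst` with the LIVE admissibility
discharged by ✔ K1 `isReflexOfTypeG_conj_iff` + `hsign` + `bar_bar`.  Inputs left to the END: the object `Dν : ObjOne (AlgHom.id ℚ L) ι₁ hν hwν Carν`
([Liu2021] Prop. 4.6 (1), h21-class), `hτ' : τ' ∈ Φ_ν` (e.g. `τ' := ῑ₁`), `hsign`, `hU7`, `h4`.  HC_CM is NOT proved; «Δ2 BRIDGE CLOSED» is NOT claimed.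
[cite: Liu2021, proof of Thm. 4.18 map (4.2)∕(4.3) (FJcycle.tex l. 2247–2253), Thm. 4.18 (1) (l. 2239), Rem. 4.17, Rem. 4.4, Lem. 2.4 (1), Def. 4.5 (2), Prop. 4.6 (1)] [cite: Shimura1998, §8.3 Prop. 28] -/
theorem adapter_socket_sharedTail {hHD : exists_isReal_hodgeModel} {hI : hodgePQ_independent_of_hodgeModel}
    {h₁ : BallQuotientUniformised} {h₃ : CMAbelianVarietyRealised} {hA : Arapura2012_Cor_15_4_6}
    [IsGalois ℚ (L : Type)] (hU7 : heckeTranslate_definedOver) (V : HodgeCM.HermSpace3 L ι₁) (h : exists_recordSystem)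
    (h4 : 4 ≤ Module.finrank ℚ L) (Φ : CMType (pkgF L))
    (iso : ∀ (F : Summit.HodgeConjecture.CorCM.CMField) (ι : F →+* ℂ) (_ : Summit.HodgeConjecture.CorCM.HermSpace3 F ι)
      (_ : CMType F), ℕ → Prop)
    (U : UniformOmega (Model.sec42DataOf h iso (pkgF L) ι₁ (pkgV V) Φ))
    {ν : Literature.NumberTheory.Automorphic.IdeleClassGroup L →ₜ* Circle} (hν : IdeleClassGroup.IsConjugateSymplectic (L : Type) ν)
    (hwν : IdeleClassGroup.HasWeight (L : Type) ν 1) (Carν : Def45.Carriers (L : Type) ν)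
    (Dν : ObjOne (AlgHom.id ℚ (L : Type)) ι₁ hν hwν Carν) (τ' : L →+* ℂ) (hτ' : τ' ∈ hν.cmType.1)
    (I : Type) (line : I → HodgeCM.Model.SplitLineE V) (i : I)
    (hsign : hν.cmType = HodgeCM.CMTypeOps.bar (HodgeCM.Model.SplitLine.typeOfLine (line i))) :
    letI := ((starRingEnd ℂ).comp ι₁).toAlgebra
    ∃ (M : (toThm418Data _ (U.rest (restTailOne (AlgHom.id ℚ (L : Type)) ι₁ hν hwν Carν
          ((Model.sec42DataOf_heckeTranslates hU7 h (pkgV V) Φ iso h4).rhoΩOne (AlgHom.id ℚ (L : Type)) ι₁ hν hwν Carν)))).Map43RationalData)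
      (jH : M.HB →ₗ[ℂ] (HodgeCM.Model.liuDictionaryPin hHD hI h₁ h₃ hA V I line).H),
      Function.Injective jH ∧
      (∀ (g : ↥V.adelicFin) (x : M.HB), jH (M.ρB g x) = MonoidAlgebra.of ℂ ↥V.adelicFin g • jH x) ∧
      ∀ (K : HodgeCM.Level V), K ≤ HodgeCM.Level.capThree (V := V)
          ((Model.sec42DataOf h iso (pkgF L) ι₁ (pkgV V) Φ).S.K₀.1 : Subgroup ↥V.adelicFin) (Model.sec42DataOf h iso (pkgF L) ι₁ (pkgV V) Φ).S.K₀.2.1 →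
        Nonempty (HcmPieces.{0, 1, 0}
          (toThm418Data _ (U.rest (restTailOne (AlgHom.id ℚ (L : Type)) ι₁ hν hwν Carν
            ((Model.sec42DataOf_heckeTranslates hU7 h (pkgV V) Φ iso h4).rhoΩOne (AlgHom.id ℚ (L : Type)) ι₁ hν hwν Carν))))
          M (HodgeCM.Model.liuDictionaryPin hHD hI h₁ h₃ hA V I line).H jH K.K
          ((HodgeCM.Model.picardCMUniverse hHD hI h₁ h₃).CohC ((HodgeCM.Model.picardCMUniverse hHD hI h₁ h₃).pms L ι₁ V K) 1)
          (resTotal hHD hI (ballQuotientUniformisedDatum_of h₁) h₃ hA K)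
          ((HodgeCM.Model.liuDictionaryPin hHD hI h₁ h₃ hA V I line).cmClasses K i)) := by
  letI := ((starRingEnd ℂ).comp ι₁).toAlgebra
  exact ⟨map43RecordAtPin (componentAlbanesePinTotal hHD hI (ballQuotientUniformisedDatum_of h₁) h₃ hA hU7 V h h4
        (Summit.HodgeConjecture.CorCM.D2Bridge.PiecesByValueConj.comp_cmConjRingHom_eq_of_starRingEnd (ι₁ := ι₁)) Φ iso)
      (AlgHom.id ℚ (L : Type)) ι₁ hν hwν Carν U.Eps U.epsOf U.Chi (U.omega ν hν) (U.rho ν hν) Dν τ' hτ',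
    jHPin (componentAlbanesePinTotal hHD hI (ballQuotientUniformisedDatum_of h₁) h₃ hA hU7 V h h4
        (Summit.HodgeConjecture.CorCM.D2Bridge.PiecesByValueConj.comp_cmConjRingHom_eq_of_starRingEnd (ι₁ := ι₁)) Φ iso)
      (AlgHom.id ℚ (L : Type)) ι₁ hν hwν Carν U.Eps U.epsOf U.Chi (U.omega ν hν) (U.rho ν hν) Dν τ' hτ',
    jHPin_injective _ (AlgHom.id ℚ (L : Type)) ι₁ hν hwν Carν U.Eps U.epsOf U.Chi (U.omega ν hν) (U.rho ν hν) Dν τ' hτ',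
    fun g x => jHPin_comm _ (AlgHom.id ℚ (L : Type)) ι₁ hν hwν Carν U.Eps U.epsOf U.Chi (U.omega ν hν) (U.rho ν hν) Dν τ' hτ' g x,
    fun K hK => nonempty_hcmPieces_atUniformRest_conjInst I (fun i => {χ : (line i).CharW // (line i).IsAutChar χ})
      (fun i a => (line i).Ω (HodgeCM.Model.ιVE V) a.1) (fun i => HodgeCM.Model.SplitLine.PhiMuLine ι₁ (line i))
      (fun i dd => dd.IsReflexOfTypeG ι₁ (HodgeCM.Model.SplitLine.typeOfLine (line i))) hν hwν Carν h
      (Model.sec42DataOf h iso (pkgF L) ι₁ (pkgV V) Φ) (Model.sec42DataOf_heckeTranslates hU7 h (pkgV V) Φ iso h4) (fun _ => rfl) U _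
      (componentAlbanesePinTotal_levelLaw hHD hI (ballQuotientUniformisedDatum_of h₁) h₃ hA hU7 V h h4
        (Summit.HodgeConjecture.CorCM.D2Bridge.PiecesByValueConj.comp_cmConjRingHom_eq_of_starRingEnd (ι₁ := ι₁)) Φ iso)
      Dν τ' hτ' i K hK fun d hd => by
        have h' := (isReflexOfTypeG_conj_iff ι₁ d hν.cmType).mp hd
        rw [hsign, HodgeCM.CMTypeOps.bar_bar] at h'
        exact h'⟩


open Summit.HodgeConjecture.CorCM.D2Bridge.AdapterMuConj (muConj thm418C_liuDictionaryPin_of_muConj)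

set_option synthInstance.maxHeartbeats 400000 in
set_option maxHeartbeats 3200000 in
/-- **THE μ ↦ μᶜ ADAPTER WITH (c)+(d) DISCHARGED BY VALUE** — ✔ `AdapterMuConj.thm418C_liuDictionaryPin_of_muConj` at the App-C datum of record
`C := Model.sec42DataOf h iso (pkgF L) ι₁ (pkgV V) Φ`, conjugate tails `tailC i := restTailOne (AlgHom.id ℚ L) ι₁ (hcsν i) (hwν i) (Carν i) (HT.rhoΩOne …)`
(the socket's own `ι₁`-presentation), threshold `Ks := Level.capThree K₀`, and the five (c)(d) binders := `adapter_socket_sharedTail` (chosen per line).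
Displayed inputs: `hbad`; the uniform carriers `U i`, the characters of record `μ i` with their tails `tail i` and Ω-pin `σ ∕ hσ ∕ e ∕ he`
([Liu21] Def. 4.11∕4.12 side, of record); the conjugate characters `ν i` (`hνμ : μ i = (ν i)ᶜ`) with weight-one `hwν`, Def-4.5 carriers `Carν`,
ONE object `Dν i` of 𝒜(ν_i) (Prop. 4.6 (1)), an embedding `τ' i ∈ Φ_{ν_i}` and the T-SIGN identity `hsign : Φ_{ν_i} = Φ̄(typeOfLine (line i))`;
`hLiuC` = [Thm 4.18] AS PRINTED at the relabelled rests; the relabelled legs `hnvDC ∕ h413C ∕ h411C ∕ hsepC`; `hK`.  HC_CM is NOT proved;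
«Δ2 BRIDGE CLOSED» is NOT claimed; whether `hLiuC` is the honest reading is the referees' W-A∕W-C call.
[cite: Liu2021, Thm. 4.18 (FJcycle.tex l. 2232–2245) with (1) and proof map (4.2)∕(4.3) (l. 2247–2253), Rem. 4.4, Prop. 4.6 (1), Def. 4.5 (2), Def. 4.11, Def. 4.12, Prop. 4.13, App. D Lem. D.1 (1)–(3)] [cite: Shimura1998, §8.3 Prop. 28] -/
theorem thm418C_liuDictionaryPin_of_muConj_byValue {hHD : exists_isReal_hodgeModel} {hI : hodgePQ_independent_of_hodgeModel}
    {h₁ : BallQuotientUniformised} {h₃ : CMAbelianVarietyRealised} {hA : Arapura2012_Cor_15_4_6}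
    [IsGalois ℚ (L : Type)] (hU7 : heckeTranslate_definedOver) (V : HodgeCM.HermSpace3 L ι₁) (h : exists_recordSystem)
    (h4 : 4 ≤ Module.finrank ℚ L) (Φ : CMType (pkgF L))
    (iso : ∀ (F : Summit.HodgeConjecture.CorCM.CMField) (ι : F →+* ℂ) (_ : Summit.HodgeConjecture.CorCM.HermSpace3 F ι)
      (_ : CMType F), ℕ → Prop)
    (I : Type) (line : I → HodgeCM.Model.SplitLineE V) (Good : I → Prop)
    (hbad : ∀ i : I, HodgeCM.Model.SplitLine.PhiMuLine ι₁ (line i) → ¬ Good i →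
      (HodgeCM.Model.liuDictionaryPin hHD hI h₁ h₃ hA V I line).block i = ⊥)
    (U : ∀ i : I, HodgeCM.Model.SplitLine.PhiMuLine ι₁ (line i) → Good i → UniformOmega (Model.sec42DataOf h iso (pkgF L) ι₁ (pkgV V) Φ))
    (μ : ∀ (i : I) (_ : HodgeCM.Model.SplitLine.PhiMuLine ι₁ (line i)) (_ : Good i),
      Literature.NumberTheory.Automorphic.IdeleClassGroup (L : Type) →ₜ* Circle)
    (hcs : ∀ (i : I) (hμ : HodgeCM.Model.SplitLine.PhiMuLine ι₁ (line i)) (hg : Good i), IdeleClassGroup.IsConjugateSymplectic (L : Type) (μ i hμ hg))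
    (tail : ∀ (i : I) (hμ : HodgeCM.Model.SplitLine.PhiMuLine ι₁ (line i)) (hg : Good i),
      RestTail (Model.sec42DataOf h iso (pkgF L) ι₁ (pkgV V) Φ) (μ i hμ hg) (hcs i hμ hg))
    (ν : ∀ (i : I) (_ : HodgeCM.Model.SplitLine.PhiMuLine ι₁ (line i)) (_ : Good i),
      Literature.NumberTheory.Automorphic.IdeleClassGroup (L : Type) →ₜ* Circle)
    (hcsν : ∀ (i : I) (hμ : HodgeCM.Model.SplitLine.PhiMuLine ι₁ (line i)) (hg : Good i), IdeleClassGroup.IsConjugateSymplectic (L : Type) (ν i hμ hg))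
    (hwν : ∀ (i : I) (hμ : HodgeCM.Model.SplitLine.PhiMuLine ι₁ (line i)) (hg : Good i), IdeleClassGroup.HasWeight (L : Type) (ν i hμ hg) 1)
    (Carν : ∀ (i : I) (hμ : HodgeCM.Model.SplitLine.PhiMuLine ι₁ (line i)) (hg : Good i), Def45.Carriers (L : Type) (ν i hμ hg))
    (Dν : ∀ (i : I) (hμ : HodgeCM.Model.SplitLine.PhiMuLine ι₁ (line i)) (hg : Good i),
      ObjOne (AlgHom.id ℚ (L : Type)) ι₁ (hcsν i hμ hg) (hwν i hμ hg) (Carν i hμ hg))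
    (τ' : ∀ (i : I) (_ : HodgeCM.Model.SplitLine.PhiMuLine ι₁ (line i)) (_ : Good i), L →+* ℂ)
    (hτ' : ∀ (i : I) (hμ : HodgeCM.Model.SplitLine.PhiMuLine ι₁ (line i)) (hg : Good i), τ' i hμ hg ∈ (hcsν i hμ hg).cmType.1)
    (hsign : ∀ (i : I) (hμ : HodgeCM.Model.SplitLine.PhiMuLine ι₁ (line i)) (hg : Good i),
      (hcsν i hμ hg).cmType = HodgeCM.CMTypeOps.bar (HodgeCM.Model.SplitLine.typeOfLine (line i)))
    (hνμ : ∀ (i : I) (hμ : HodgeCM.Model.SplitLine.PhiMuLine ι₁ (line i)) (hg : Good i),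
      μ i hμ hg = IdeleClassGroup.galConj (IsCMField.complexConj (L : Type)) (ν i hμ hg))
    -- [Liu21, Thm 4.18] AS PRINTED for `ν_i = μ_iᶜ` at the relabelled rest on the shared tail (the ONE displayed instance of the adapter)
    (hLiuC : ∀ (i : I) (hμ : HodgeCM.Model.SplitLine.PhiMuLine ι₁ (line i)) (hg : Good i),
      Thm418AsPrinted (toThm418Data _ ((muConj (U i hμ hg)).rest (restTailOne (AlgHom.id ℚ (L : Type)) ι₁ (hcsν i hμ hg) (hwν i hμ hg) (Carν i hμ hg)
        ((Model.sec42DataOf_heckeTranslates hU7 h (pkgV V) Φ iso h4).rhoΩOne (AlgHom.id ℚ (L : Type)) ι₁ (hcsν i hμ hg) (hwν i hμ hg) (Carν i hμ hg))))))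
    -- (b) the Ω-PIN OF RECORD at the `μ_i`-rests
    (σ : ∀ (i : I) (hμ : HodgeCM.Model.SplitLine.PhiMuLine ι₁ (line i)) (hg : Good i),
      {χ : (line i).CharW // (line i).IsAutChar χ} → (toThm418Data _ ((U i hμ hg).rest (tail i hμ hg))).AdmIndex)
    (hσ : ∀ (i : I) (hμ : HodgeCM.Model.SplitLine.PhiMuLine ι₁ (line i)) (hg : Good i), Function.Injective (σ i hμ hg))
    (e : ∀ (i : I) (hμ : HodgeCM.Model.SplitLine.PhiMuLine ι₁ (line i)) (hg : Good i) (a : {χ : (line i).CharW // (line i).IsAutChar χ}),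
      (line i).Ω (HodgeCM.Model.ιVE V) a.1 ≃ₗ[ℂ] (toThm418Data _ ((U i hμ hg).rest (tail i hμ hg))).omegaAt (σ i hμ hg a))
    (he : ∀ (i : I) (hμ : HodgeCM.Model.SplitLine.PhiMuLine ι₁ (line i)) (hg : Good i) (a : {χ : (line i).CharW // (line i).IsAutChar χ})
      (g : ↥V.adelicFin) (m : (line i).Ω (HodgeCM.Model.ιVE V) a.1),
      e i hμ hg a (MonoidAlgebra.of ℂ ↥V.adelicFin g • m) = (toThm418Data _ ((U i hμ hg).rest (tail i hμ hg))).rhoAt (σ i hμ hg a) g (e i hμ hg a m))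
    -- the relabelled legs (A3: transported from the un-relabelled displays by adapt-2∕adapt-3's lemmas)
    (hnvDC : ∀ (i : I) (hμ : HodgeCM.Model.SplitLine.PhiMuLine ι₁ (line i)) (hg : Good i)
      (j : (toThm418Data _ ((muConj (U i hμ hg)).rest (restTailOne (AlgHom.id ℚ (L : Type)) ι₁ (hcsν i hμ hg) (hwν i hμ hg) (Carν i hμ hg)
        ((Model.sec42DataOf_heckeTranslates hU7 h (pkgV V) Φ iso h4).rhoΩOne (AlgHom.id ℚ (L : Type)) ι₁ (hcsν i hμ hg) (hwν i hμ hg) (Carν i hμ hg))))).AdmIndex),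
      Nontrivial ((toThm418Data _ ((muConj (U i hμ hg)).rest (restTailOne (AlgHom.id ℚ (L : Type)) ι₁ (hcsν i hμ hg) (hwν i hμ hg) (Carν i hμ hg)
        ((Model.sec42DataOf_heckeTranslates hU7 h (pkgV V) Φ iso h4).rhoΩOne (AlgHom.id ℚ (L : Type)) ι₁ (hcsν i hμ hg) (hwν i hμ hg) (Carν i hμ hg))))).omegaAt j))
    (h413C : ∀ (i : I) (hμ : HodgeCM.Model.SplitLine.PhiMuLine ι₁ (line i)) (hg : Good i),
      Prop413AsPrinted ((muConj (U i hμ hg)).prop413Data (HodgeCM.Model.liuDictionaryPin hHD hI h₁ h₃ hA V I line).H))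
    (h411C : ∀ (i : I) (hμ : HodgeCM.Model.SplitLine.PhiMuLine ι₁ (line i)) (hg : Good i)
      (t : ((muConj (U i hμ hg)).prop413Data (HodgeCM.Model.liuDictionaryPin hHD hI h₁ h₃ hA V I line).H).AdmTriple),
      IsIrreducibleOrZero (((muConj (U i hμ hg)).prop413Data (HodgeCM.Model.liuDictionaryPin hHD hI h₁ h₃ hA V I line).H).rhoAt t) ∧
      IsSmoothRep (((muConj (U i hμ hg)).prop413Data (HodgeCM.Model.liuDictionaryPin hHD hI h₁ h₃ hA V I line).H).rhoAt t) ∧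
      IsAdmissibleRep (((muConj (U i hμ hg)).prop413Data (HodgeCM.Model.liuDictionaryPin hHD hI h₁ h₃ hA V I line).H).rhoAt t))
    (hsepC : ∀ (i : I) (hμ : HodgeCM.Model.SplitLine.PhiMuLine ι₁ (line i)) (hg : Good i)
      (s t : ((muConj (U i hμ hg)).prop413Data (HodgeCM.Model.liuDictionaryPin hHD hI h₁ h₃ hA V I line).H).AdmTriple),
      Nontrivial (((muConj (U i hμ hg)).prop413Data (HodgeCM.Model.liuDictionaryPin hHD hI h₁ h₃ hA V I line).H).omegaAt s) →
      (∃ f : ((muConj (U i hμ hg)).prop413Data (HodgeCM.Model.liuDictionaryPin hHD hI h₁ h₃ hA V I line).H).omegaAt s ≃ₗ[ℂ]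
          ((muConj (U i hμ hg)).prop413Data (HodgeCM.Model.liuDictionaryPin hHD hI h₁ h₃ hA V I line).H).omegaAt t,
        ∀ (g : ↥V.adelicFin) (v : ((muConj (U i hμ hg)).prop413Data (HodgeCM.Model.liuDictionaryPin hHD hI h₁ h₃ hA V I line).H).omegaAt s),
          f (((muConj (U i hμ hg)).prop413Data (HodgeCM.Model.liuDictionaryPin hHD hI h₁ h₃ hA V I line).H).rhoAt s g v) =
            ((muConj (U i hμ hg)).prop413Data (HodgeCM.Model.liuDictionaryPin hHD hI h₁ h₃ hA V I line).H).rhoAt t g (f v)) → s = t)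
    (hK : ∃ K : Subgroup ↥V.adelicFin, IsOpenCompact K) :
    (HodgeCM.Model.liuDictionaryPin hHD hI h₁ h₃ hA V I line).Thm418C := by
  letI := ((starRingEnd ℂ).comp ι₁).toAlgebra
  have S := fun (i : I) (hμ : HodgeCM.Model.SplitLine.PhiMuLine ι₁ (line i)) (hg : Good i) =>
    adapter_socket_sharedTail (hHD := hHD) (hI := hI) (h₁ := h₁) (h₃ := h₃) (hA := hA) hU7 V h h4 Φ iso (muConj (U i hμ hg))
      (hcsν i hμ hg) (hwν i hμ hg) (Carν i hμ hg) (Dν i hμ hg) (τ' i hμ hg) (hτ' i hμ hg) I line i (hsign i hμ hg)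
  exact thm418C_liuDictionaryPin_of_muConj V I line h Φ (Model.sec42DataOf h iso (pkgF L) ι₁ (pkgV V) Φ) Good hbad U μ hcs tail ν hcsν
    (fun i hμ hg => restTailOne (AlgHom.id ℚ (L : Type)) ι₁ (hcsν i hμ hg) (hwν i hμ hg) (Carν i hμ hg)
      ((Model.sec42DataOf_heckeTranslates hU7 h (pkgV V) Φ iso h4).rhoΩOne (AlgHom.id ℚ (L : Type)) ι₁ (hcsν i hμ hg) (hwν i hμ hg) (Carν i hμ hg)))
    hνμ hLiuC σ hσ e he
    (fun i hμ hg => (S i hμ hg).choose) (fun i hμ hg => (S i hμ hg).choose_spec.choose)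
    (fun i hμ hg => (S i hμ hg).choose_spec.choose_spec.1) (fun i hμ hg => (S i hμ hg).choose_spec.choose_spec.2.1)
    (fun _ => HodgeCM.Level.capThree (V := V)
      ((Model.sec42DataOf h iso (pkgF L) ι₁ (pkgV V) Φ).S.K₀.1 : Subgroup ↥V.adelicFin) (Model.sec42DataOf h iso (pkgF L) ι₁ (pkgV V) Φ).S.K₀.2.1)
    (fun i hμ hg K hK => Classical.choice ((S i hμ hg).choose_spec.choose_spec.2.2 K hK))
    hnvDC h413C h411C hsepC hK

end Summit.HodgeConjecture.CorCM.D2Bridge.AdapterMuConjByValue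

end
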